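import Literature.NumberTheory.DiophantineGeometry.BelyiTheorem
import Literature.NumberTheory.DiophantineGeometry.PlaneCurvePlacesAtPointsProofs
import HarnessLib

/-!
# `deg_B(E) = 3` for the elliptic curves `y² = x³ + a₆`: the bound `deg_B ≥ 2g + 1` is sharp

Topic `NumberTheory/DiophantineGeometry`; companion of `BelyiDegreeFaltingsHeightProofs.lean`
(Javanpeykar 2014, Lemma 3.2.2: `deg_B(X) ≥ 2g + 1`, and `three_le_belyiDegree` for elliptic
function fields) and `BelyiTheorem.lean`. For the elliptic curves `E : y² = x³ + a₆` (`j = 0`;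
Weierstrass models with `a₁ = a₂ = a₃ = a₄ = 0`) over an algebraically closed field `K` of
characteristic `0` we compute the Belyi degree of the function field `K(E)` exactly:

* `WeierstrassBelyi.ord_infPlace_y`, `finrank_adjoin_y` — for ANY Weierstrass curve, `y` has a
  single pole, of order `3`, at `P_∞`, so **`[K(W) : K(y)] = 3`** (`sum_neg_ord_eq_finrank`);
* `WeierstrassBelyi.algebraMap_mk_eq_evalEval`, `polynomial_dvd_of_evalEval_eq_zero`,
  `exists_evalEval_div` — the model `K(W) = Frac(K[X][Y]/(Φ))` in the form consumed by
  `PlaneCurvePlacesAtPointsProofs.exists_place_of_derivative_swap_ne_zero`;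
* `WeierstrassBelyi.exists_place_over`, `ord_y_sub_eq_one` — for `y² = x³ + a₆` and `β² ≠ a₆`
  the three points `(α, β)`, `α³ = β² - a₆`, are nonsingular with `∂Φ/∂x ≠ 0`, hence carry three
  distinct places, and since `Σ_P v_P(y - β) = [K(W) : K(y)] = 3` **every zero of `y - β` is
  simple**: `y : E → ℙ¹` is branched only over `y = ±b` (`b² = a₆`) and `∞`;
* `WeierstrassBelyi.isBelyiFunction`, `finrank_adjoin_f` — **`f = (y + b)/(2b)` is a Belyi function
  of degree `3`**;
* `WeierstrassBelyi.belyiDegree_eq_three` — **`deg_B(K(E)) = 3`**, so Lemma 3.2.2's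
  `deg_B ≥ 2g + 1` is sharp in genus `1`;
* the double cover: `WeierstrassBelyi.ord_infPlace_x`, `finrank_adjoin_x` (**`[K(W) : K(x)] = 2`**,
  Silverman Cor. III.3.1.1), `evalEval_derivative_polynomial`, `ord_x_sub_eq_one` (for
  `a₁ = a₃ = 0`, `x - α` has only simple zeros when the cubic does not vanish at `α`: **`x` is
  unramified away from the `2`-torsion**), and for `y² = x³ + a₄x` (`j = 1728`):
  `isBelyiFunction_j1728` (`-x²/a₄` is Belyi), `finrank_adjoin_j1728` (degree `4`),
  `belyiDegree_j1728` (**`3 ≤ deg_B ≤ 4`**);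
* `AlgFunctionField.IsBelyiFunction.ord_eq_three_of_finrank_eq_three` — conversely, **a Belyi
  function of degree `3` on a genus-one function field is totally ramified over `0, 1, ∞`** (one
  place in each fibre, of index `3`: the cusp count `n₀ + n₁ + n_∞ = d + 2 - 2g = 3`);
* `belyiDegree_baseChange_eq_three`, `javanpeykar2014_stableFaltingsHeight_le.j_zero` — in the
  setting of the named fact: for `E : y² = x³ + B` over a number field, `deg_B(E_Ω) = 3` and the
  fact's bound reads `h_F(E) ≤ 13·10⁶·3⁵` (its least possible value; Deligne: `h_F = -1.32…`).

Theorems only; no definition, no named fact.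

## References

* A. Javanpeykar, *Polynomial bounds for Arakelov invariants of Belyi curves*, Algebra & Number
  Theory 8 (2014), Lemma 3.2.2 and Thm. 1.1.1. [Javanpeykar2014]
* J. H. Silverman, *The Arithmetic of Elliptic Curves*, 2nd ed., GTM 106 (2009), Prop. III.3.1.
  [SilvermanAEC2009]
* W. Fulton, *Algebraic Curves*, 3rd ed. (2008), §3.2. [Fulton2008]
-/

noncomputable section

open scoped IntermediateField Polynomial.Bivariate
open Polynomial WithZero

namespace Literature.NumberTheory.DiophantineGeometry

open AlgFunctionField WeierstrassPlaceAtInfinity WeierstrassPlaces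

universe u

variable {K : Type u} [Field K] (W : WeierstrassCurve.Affine K)

/-- The function `y ∈ K(W)`. -/
local notation "yF" W => algebraMap (WeierstrassCurve.Affine.CoordinateRing W)
  (WeierstrassCurve.Affine.FunctionField W) (WeierstrassCurve.Affine.CoordinateRing.mk W Y)

/-- The function `x ∈ K(W)`. -/
local notation "xF" W => algebraMap (Polynomial K) (WeierstrassCurve.Affine.FunctionField W) X

namespace WeierstrassBelyi

/-! ### `y` has a single pole, of order `3`, at infinity -/

/-- `v_∞(y) = -3`. [cite: SilvermanAEC2009, Prop. III.3.1 (proof of (a))] -/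
theorem ord_infPlace_y : (infPlace W).ord (yF W) = -3 := by
  have hval := infValuationF_y W
  have hy0 : (yF W) ≠ 0 := by
    intro h; rw [h, Valuation.map_zero] at hval; exact (coe_ne_zero).symm hval |>.elim
  have key : ∀ n : ℤ, (-n ≤ (infPlace W).ord (yF W)) ↔ 3 ≤ n := by
    intro n
    rw [← (infPlace W).valuation_le_zpow_iff_le_ord hy0 (-n),
      WeierstrassGenus.infPlace_valuation_le_iff, hval,
      exp_le_exp]
  have h3 := (key 3).2 le_rfl
  have h2 : ¬ (-2 ≤ (infPlace W).ord (yF W)) := fun h ↦ by have := (key 2).1 h; omega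
  omega

/-- `y ∉ K`. [folklore] -/
theorem y_not_mem_range : (yF W) ∉ Set.range (algebraMap K W.FunctionField) := by
  rintro ⟨c, hc⟩
  have h := ord_infPlace_y W
  rw [← hc] at h
  rcases eq_or_ne c 0 with rfl | hc0
  · rw [map_zero, PlaceOver.ord_zero] at h; omega
  · rw [PlaceOver.ord_algebraMap_holds _ hc0] at h; omega

variable [IsDedekindDomain W.CoordinateRing]

/-- `y` is integral at every finite place. [folklore] -/
theorem y_mem_ofPrime (v : IsDedekindDomain.HeightOneSpectrum W.CoordinateRing) :
    (yF W) ∈ (PlaceOver.ofPrime K W.FunctionField v).toValuationSubring := by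
  rw [PlaceOver.mem_ofPrime_iff]
  exact v.valuation_le_one _

/-- The only pole of `y` is `P_∞`. [folklore] -/
theorem eq_infPlace_of_ord_y_neg {P : PlaceOver K W.FunctionField} (hP : P.ord (yF W) < 0) :
    P = infPlace W := by
  rcases eq_infPlace_or_exists_eq_ofPrime W P with rfl | ⟨v, rfl⟩
  · rfl
  · exfalso
    have hy0 : (yF W) ≠ 0 := by
      intro h; rw [h, PlaceOver.ord_zero] at hP; exact lt_irrefl _ hP
    have := ((PlaceOver.ofPrime K W.FunctionField v).mem_toValuationSubring_iff_ord_nonneg hy0).1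
      (y_mem_ofPrime W v)
    omega

variable [IsAlgClosed K]

/-- **`[K(W) : K(y)] = 3`**: the only pole of `y` is `P_∞`, of order `3`
(`sum_neg_ord_eq_finrank`). [cite: SilvermanAEC2009, Prop. III.3.1] -/
theorem finrank_adjoin_y : Module.finrank K⟮yF W⟯ W.FunctionField = 3 := by
  classical
  have hrat : ∀ P : PlaceOver K W.FunctionField, P.IsRational :=
    PlaceOver.isRational_of_isAlgClosed
  have h := sum_neg_ord_eq_finrank hrat (y_not_mem_range W) {infPlace W}
    (fun P hP ↦ by rw [Finset.mem_singleton.1 hP, ord_infPlace_y]; norm_num)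
    (fun P hP ↦ Finset.mem_singleton.2 (eq_infPlace_of_ord_y_neg W hP))
  rw [Finset.sum_singleton, ord_infPlace_y] at h
  norm_num at h
  exact_mod_cast h.symm

/-! ### The model `K(W) = Frac(K[X][Y]/(Φ))`: evaluation, kernel, fractions -/

omit [IsDedekindDomain W.CoordinateRing] [IsAlgClosed K] in
/-- The image in `K(W)` of the class of `G ∈ K[X][Y]` is `G(x, y)`. [folklore] -/
theorem algebraMap_mk_eq_evalEval (G : K[X][Y]) :
    algebraMap W.CoordinateRing W.FunctionField (WeierstrassCurve.Affine.CoordinateRing.mk W G) =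
      (G.map (mapRingHom (algebraMap K W.FunctionField))).evalEval (xF W) (yF W) := by
  have h : (algebraMap W.CoordinateRing W.FunctionField).comp
        (WeierstrassCurve.Affine.CoordinateRing.mk W) =
      (evalEvalRingHom (xF W) (yF W)).comp
        (mapRingHom (mapRingHom (algebraMap K W.FunctionField))) := by
    refine Polynomial.ringHom_ext (fun q ↦ ?_) ?_
    · rw [RingHom.comp_apply, RingHom.comp_apply, coe_mapRingHom, Polynomial.map_C,
        coe_evalEvalRingHom, evalEval_C, coe_mapRingHom, eval_map_algebraMap,
        WeierstrassCurve.Affine.CoordinateRing.mk, AdjoinRoot.mk_C, ← AdjoinRoot.algebraMap_eq,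
        ← IsScalarTower.algebraMap_apply, algebraMap_polynomial_eq_aeval]
    · rw [RingHom.comp_apply, RingHom.comp_apply, coe_mapRingHom, Polynomial.map_X,
        coe_evalEvalRingHom, evalEval_X]
  exact congr($h G)

omit [IsDedekindDomain W.CoordinateRing] [IsAlgClosed K] in
/-- `Φ(x, y) = 0` in `K(W)`. [folklore] -/
theorem evalEval_polynomial_eq_zero :
    (W.polynomial.map (mapRingHom (algebraMap K W.FunctionField))).evalEval (xF W) (yF W) = 0 := by
  rw [← algebraMap_mk_eq_evalEval, WeierstrassCurve.Affine.CoordinateRing.mk, AdjoinRoot.mk_self,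
    map_zero]

omit [IsDedekindDomain W.CoordinateRing] [IsAlgClosed K] in
/-- The relations of `x, y` are the multiples of `Φ`: `G(x, y) = 0 ⇒ Φ ∣ G`. [folklore] -/
theorem polynomial_dvd_of_evalEval_eq_zero [W.IsElliptic] (G : K[X][Y])
    (hG : (G.map (mapRingHom (algebraMap K W.FunctionField))).evalEval (xF W) (yF W) = 0) :
    W.polynomial ∣ G := by
  rw [← algebraMap_mk_eq_evalEval] at hG
  have h0 : WeierstrassCurve.Affine.CoordinateRing.mk W G = 0 :=
    (IsFractionRing.injective W.CoordinateRing W.FunctionField) (by rw [hG, map_zero])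
  rwa [WeierstrassCurve.Affine.CoordinateRing.mk, AdjoinRoot.mk_eq_zero] at h0

omit [IsDedekindDomain W.CoordinateRing] [IsAlgClosed K] in
/-- Every element of `K(W)` is a quotient `G(x, y)/H(x, y)`. [folklore] -/
theorem exists_evalEval_div [W.IsElliptic] (z : W.FunctionField) :
    ∃ G H : K[X][Y],
      (H.map (mapRingHom (algebraMap K W.FunctionField))).evalEval (xF W) (yF W) ≠ 0 ∧
      z * (H.map (mapRingHom (algebraMap K W.FunctionField))).evalEval (xF W) (yF W) =
        (G.map (mapRingHom (algebraMap K W.FunctionField))).evalEval (xF W) (yF W) := by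
  obtain ⟨r, s, hs, rfl⟩ := IsFractionRing.div_surjective (A := W.CoordinateRing) z
  obtain ⟨G, rfl⟩ := AdjoinRoot.mk_surjective r
  obtain ⟨H, rfl⟩ := AdjoinRoot.mk_surjective s
  have hs0 : algebraMap W.CoordinateRing W.FunctionField (AdjoinRoot.mk W.polynomial H) ≠ 0 :=
    IsFractionRing.to_map_ne_zero_of_mem_nonZeroDivisors hs
  refine ⟨G, H, ?_, ?_⟩
  · rwa [← algebraMap_mk_eq_evalEval]
  · rw [← algebraMap_mk_eq_evalEval, ← algebraMap_mk_eq_evalEval]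
    exact div_mul_cancel₀ _ hs0

/-! ### The places over `y = β` for `y² = x³ + a₆` -/

omit [IsDedekindDomain W.CoordinateRing] [IsAlgClosed K] in
/-- For `W : y² = x³ + a₆` (`a₁ = a₂ = a₃ = a₄ = 0`) and `α³ = β² - a₆ ≠ 0`: the point `(α, β)` is
a nonsingular point with `∂Φ/∂x (α, β) = -3α² ≠ 0`, so there is a unique place centred at it; in
particular a place `P` with `v_P(x - α) > 0`, `v_P(y - β) > 0`. [cite: Fulton2008, §3.2] -/
theorem exists_place_over [W.IsElliptic] [CharZero K] (h₁ : W.a₁ = 0) (h₂ : W.a₂ = 0)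
    (h₃ : W.a₃ = 0) (h₄ : W.a₄ = 0) {α β : K} (hαβ : α ^ 3 = β ^ 2 - W.a₆) (hα : α ≠ 0) :
    ∃ P : PlaceOver K W.FunctionField,
      (xF W) ∈ P.toValuationSubring ∧ (yF W) ∈ P.toValuationSubring ∧
      P.valuation ((xF W) - algebraMap K W.FunctionField α) < 1 ∧
      P.valuation ((yF W) - algebraMap K W.FunctionField β) < 1 := by
  have hyb : (yF W) ≠ algebraMap K W.FunctionField β := fun h ↦ y_not_mem_range W ⟨β, h.symm⟩
  have hab : W.polynomial.evalEval α β = 0 := by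
    rw [WeierstrassCurve.Affine.evalEval_polynomial, h₁, h₂, h₃, h₄]
    linear_combination -hαβ
  have hder : (derivative (Bivariate.swap W.polynomial)).evalEval β α ≠ 0 := by
    have hswap : Bivariate.swap W.polynomial =
        C X * C (C W.a₁) * Y + C X * C (C W.a₃) + C X ^ 2 - Y * C (C W.a₄) -
          Y ^ 2 * C (C W.a₂) - Y ^ 3 - C (C W.a₆) := by
      rw [WeierstrassCurve.Affine.polynomial]
      simp only [map_add, map_sub, map_mul, map_pow, Bivariate.swap_Y, Bivariate.swap_C,
        Polynomial.map_X, Polynomial.map_C]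
      ring
    rw [hswap, h₁, h₂, h₃, h₄]
    simp only [map_zero, mul_zero, zero_add, sub_zero, derivative_sub,
      derivative_C, derivative_X, derivative_pow, zero_mul, mul_one, Nat.cast_ofNat,
      mul_zero, zero_sub, add_zero]
    norm_num
    refine ⟨?_, hα⟩
    rw [evalEval_C]
    norm_num
  obtain ⟨P, -, hx, hy, hvx, hvy, -⟩ := exists_place_of_derivative_swap_ne_zero
    (evalEval_polynomial_eq_zero W) (polynomial_dvd_of_evalEval_eq_zero W) (exists_evalEval_div W)
    hyb hab hder
  exact ⟨P, hx, hy, hvx, hvy⟩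

omit [IsDedekindDomain W.CoordinateRing] [IsAlgClosed K] in
/-- Places centred at different `x`-coordinates are different. [folklore] -/
theorem ne_of_valuation_x_sub_lt {P : PlaceOver K W.FunctionField} {α α' : K}
    (h : P.valuation ((xF W) - algebraMap K W.FunctionField α) < 1)
    (h' : P.valuation ((xF W) - algebraMap K W.FunctionField α') < 1) : α = α' := by
  by_contra hne
  have hc : α' - α ≠ 0 := sub_ne_zero.2 (Ne.symm hne)
  have hv1 : P.valuation (algebraMap K W.FunctionField (α' - α)) = 1 := by
    rw [P.valuation_eq_zpow_ord ((_root_.map_ne_zero _).2 hc), PlaceOver.ord_algebraMap_holds P hc,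
      zpow_zero]
  have heq : algebraMap K W.FunctionField (α' - α) =
      ((xF W) - algebraMap K W.FunctionField α) - ((xF W) - algebraMap K W.FunctionField α') := by
    rw [map_sub]; ring
  have hlt : P.valuation (algebraMap K W.FunctionField (α' - α)) < 1 := by
    rw [heq]
    exact lt_of_le_of_lt (Valuation.map_sub _ _ _) (max_lt h h')
  rw [hv1] at hlt
  exact lt_irrefl _ hlt

/-- **The fibres of `y` are simple off the branch values**: for `W : y² = x³ + a₆` and
`β² ≠ a₆`, every zero of `y - β` is simple (`v_P(y - β) = 1`). Proof: the three points
`(α, β)`, `α³ = β² - a₆`, carry three distinct places with `v(y - β) ≥ 1`, and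
`Σ_P v_P(y - β) = [K(W) : K(y)] = 3`. [cite: SilvermanAEC2009, Prop. III.3.1] -/
theorem ord_y_sub_eq_one [W.IsElliptic] [CharZero K] (h₁ : W.a₁ = 0) (h₂ : W.a₂ = 0)
    (h₃ : W.a₃ = 0) (h₄ : W.a₄ = 0) {β : K} (hβ : β ^ 2 ≠ W.a₆) {P : PlaceOver K W.FunctionField}
    (hP : 0 < P.ord ((yF W) - algebraMap K W.FunctionField β)) :
    P.ord ((yF W) - algebraMap K W.FunctionField β) = 1 := by
  classical
  have hrat : ∀ P : PlaceOver K W.FunctionField, P.IsRational :=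
    PlaceOver.isRational_of_isAlgClosed
  set γ : K := β ^ 2 - W.a₆ with hγ
  have hγ0 : γ ≠ 0 := sub_ne_zero.2 hβ
  -- three distinct cube roots of `γ`
  obtain ⟨α₁, hα₁⟩ := IsAlgClosed.exists_pow_nat_eq γ (by norm_num : 0 < 3)
  obtain ⟨ω, hω⟩ := IsAlgClosed.exists_root (X ^ 2 + X + 1 : K[X]) (by
    intro h0
    have h2 : (X ^ 2 + X + 1 : K[X]).natDegree = 2 := by compute_degree!
    have := Polynomial.natDegree_eq_zero_iff_degree_le_zero.mpr h0.le
    omega)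
  simp only [IsRoot.def, eval_add, eval_pow, eval_X, eval_one] at hω
  have hω3 : ω ^ 3 = 1 := by linear_combination (ω - 1) * hω
  have hω1 : ω ≠ 1 := by
    intro h; rw [h] at hω; norm_num at hω
  have hω2 : ω ^ 2 ≠ 1 := by
    intro h
    have h2 : ω = -2 := by linear_combination hω - h
    rw [h2] at hω; norm_num at hω
  have hα₁0 : α₁ ≠ 0 := by rintro rfl; rw [zero_pow (by norm_num)] at hα₁; exact hγ0 hα₁.symm
  set roots : Fin 3 → K := ![α₁, ω * α₁, ω ^ 2 * α₁] with hroots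
  have hcube : ∀ i, roots i ^ 3 = β ^ 2 - W.a₆ := by
    intro i
    fin_cases i
    · exact hα₁
    · change (ω * α₁) ^ 3 = _; rw [mul_pow, hω3, one_mul, hα₁]
    · change (ω ^ 2 * α₁) ^ 3 = _
      rw [mul_pow, ← pow_mul, show 2 * 3 = 3 * 2 by norm_num, pow_mul, hω3, one_pow, one_mul, hα₁]
  have hne0 : ∀ i, roots i ≠ 0 := by
    intro i h; have := hcube i; rw [h, zero_pow (by norm_num)] at this; exact hγ0 this.symm
  have hinj : Function.Injective roots := by
    intro i j hij
    fin_cases i <;> fin_cases j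
    · rfl
    · exfalso; change α₁ = ω * α₁ at hij
      exact hω1 (mul_left_cancel₀ hα₁0 (by rw [mul_one, mul_comm]; exact hij)).symm
    · exfalso; change α₁ = ω ^ 2 * α₁ at hij
      exact hω2 (mul_left_cancel₀ hα₁0 (by rw [mul_one, mul_comm]; exact hij)).symm
    · exfalso; change ω * α₁ = α₁ at hij
      exact hω1 (mul_left_cancel₀ hα₁0 (by rw [mul_one, mul_comm]; exact hij.symm)).symm
    · rfl
    · exfalso; change ω * α₁ = ω ^ 2 * α₁ at hij
      have : ω = ω ^ 2 := mul_right_cancel₀ hα₁0 hij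
      apply hω1
      have h0 : ω * (ω - 1) = 0 := by linear_combination -this
      rcases mul_eq_zero.1 h0 with h | h
      · exfalso; rw [h] at hω; norm_num at hω
      · linear_combination h
    · exfalso; change ω ^ 2 * α₁ = α₁ at hij
      exact hω2 (mul_left_cancel₀ hα₁0 (by rw [mul_one, mul_comm]; exact hij.symm)).symm
    · exfalso; change ω ^ 2 * α₁ = ω * α₁ at hij
      have : ω ^ 2 = ω := mul_right_cancel₀ hα₁0 hij
      apply hω1
      have h0 : ω * (ω - 1) = 0 := by linear_combination this
      rcases mul_eq_zero.1 h0 with h | h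
      · exfalso; rw [h] at hω; norm_num at hω
      · linear_combination h
    · rfl
  -- the three places
  choose Q hQx hQy hvx hvy using fun i ↦ exists_place_over W h₁ h₂ h₃ h₄ (hcube i) (hne0 i)
  have hQinj : Function.Injective Q := fun i j hij ↦
    hinj (ne_of_valuation_x_sub_lt W (hvx i) (by rw [hij]; exact hvx j))
  -- the zero set of `y - β` and the sum formula
  have hyβ0 : (yF W) - algebraMap K W.FunctionField β ≠ 0 :=
    fun h ↦ y_not_mem_range W ⟨β, (sub_eq_zero.1 h).symm⟩
  set U : Finset (PlaceOver K W.FunctionField) :=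
    (finite_setOf_ord_ne_zero_holds (K := K) hyβ0).toFinset.filter
      fun P ↦ 0 < P.ord ((yF W) - algebraMap K W.FunctionField β) with hU
  have hmemU : ∀ R, R ∈ U ↔ 0 < R.ord ((yF W) - algebraMap K W.FunctionField β) := fun R ↦ by
    rw [hU, Finset.mem_filter, Set.Finite.mem_toFinset, Set.mem_setOf_eq]
    exact ⟨fun h ↦ h.2, fun h ↦ ⟨h.ne', h⟩⟩
  have hsum := sum_ord_sub_eq_finrank hrat (y_not_mem_range W) β U
    (fun R hR ↦ (hmemU R).1 hR) (fun R hR ↦ (hmemU R).2 hR)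
  rw [finrank_adjoin_y] at hsum
  -- the `Q i` lie in `U`
  have hQU : ∀ i, Q i ∈ U := fun i ↦ (hmemU _).2
    ((Q i).valuation_lt_one_iff_ord_pos hyβ0 |>.1 (hvy i))
  have himg : (Finset.univ.image Q) ⊆ U := by
    intro R hR
    obtain ⟨i, -, rfl⟩ := Finset.mem_image.1 hR
    exact hQU i
  have hcard3 : (Finset.univ.image Q).card = 3 := by
    rw [Finset.card_image_of_injective _ hQinj, Finset.card_univ, Fintype.card_fin]
  -- `Σ_U (ord - 1) = 3 - #U ≥ 0` forces `#U = 3` and all `ord = 1`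
  have hterms : ∀ R ∈ U, 1 ≤ R.ord ((yF W) - algebraMap K W.FunctionField β) :=
    fun R hR ↦ (hmemU R).1 hR
  have hcardU : U.card ≤ 3 := by
    have h := Finset.sum_le_sum hterms
    rw [Finset.sum_const, nsmul_eq_mul, mul_one, hsum] at h
    exact_mod_cast h
  have hUeq : Finset.univ.image Q = U :=
    Finset.eq_of_subset_of_card_le himg (by rw [hcard3]; exact hcardU)
  have hcardU3 : U.card = 3 := by rw [← hUeq, hcard3]
  have hPU : P ∈ U := (hmemU P).2 hP
  -- if `ord_P > 1` the sum would exceed `3`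
  by_contra hne
  have hgt : 2 ≤ P.ord ((yF W) - algebraMap K W.FunctionField β) := by
    have := hterms P hPU; omega
  have h := Finset.add_sum_erase U (fun R ↦ R.ord ((yF W) - algebraMap K W.FunctionField β)) hPU
  have hrest : ((U.erase P).card : ℤ) ≤
      ∑ R ∈ U.erase P, R.ord ((yF W) - algebraMap K W.FunctionField β) := by
    have h2 := Finset.sum_le_sum (s := U.erase P) fun R hR ↦ hterms R (Finset.mem_of_mem_erase hR)
    rwa [Finset.sum_const, nsmul_eq_mul, mul_one] at h2
  rw [Finset.card_erase_of_mem hPU, hcardU3] at hrest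
  rw [hsum] at h
  push_cast at hrest h
  linarith

/-! ### The Belyi function `f = (y + b)/(2b)`, `b² = a₆`, and `deg_B = 3` -/

/-- **A Belyi function of degree `3` on `y² = x³ + a₆`**: for `b² = a₆ ≠ 0`, the function
`f = (y + b)/(2b)` is a Belyi function — `y : E → ℙ¹` has degree `3` and is branched only over
`y = ±b` (where `x³ = 0`) and `∞`, and `f` moves `{-b, b, ∞}` to `{0, 1, ∞}`.
[cite: Javanpeykar2014, Lemma 3.2.2 (sharpness for g = 1)] -/
theorem isBelyiFunction [W.IsElliptic] [CharZero K] (h₁ : W.a₁ = 0) (h₂ : W.a₂ = 0)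
    (h₃ : W.a₃ = 0) (h₄ : W.a₄ = 0) {b : K} (hb : b ^ 2 = W.a₆) (hb0 : b ≠ 0) :
    IsBelyiFunction K (((yF W) + algebraMap K W.FunctionField b) /
      algebraMap K W.FunctionField (2 * b)) := by
  set f := ((yF W) + algebraMap K W.FunctionField b) / algebraMap K W.FunctionField (2 * b) with hf
  have h2b : (2 * b : K) ≠ 0 := mul_ne_zero two_ne_zero hb0
  have h2bF : algebraMap K W.FunctionField (2 * b) ≠ 0 := (_root_.map_ne_zero _).2 h2b
  refine ⟨?_, ?_⟩
  · -- `f ∉ K`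
    rintro ⟨c, hc⟩
    apply y_not_mem_range W
    refine ⟨c * (2 * b) - b, ?_⟩
    have : (yF W) = f * algebraMap K W.FunctionField (2 * b) - algebraMap K W.FunctionField b := by
      rw [hf, div_mul_cancel₀ _ h2bF]; ring
    rw [this, ← hc, map_sub, map_mul]
  · intro c hc0 hc1 P hP
    -- `f - c = (y - β)/(2b)` with `β = b (2c - 1)`, `β² ≠ a₆`
    set β : K := 2 * b * c - b with hβ
    have hβ2 : β ^ 2 ≠ W.a₆ := by
      intro h
      rw [← hb, hβ] at h
      have h' : (4 * b ^ 2) * (c * (c - 1)) = 0 := by linear_combination h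
      rcases mul_eq_zero.1 h' with h'' | h''
      · exact hb0 (by simpa using h'')
      · rcases mul_eq_zero.1 h'' with h3 | h3
        · exact hc0 h3
        · exact hc1 (by linear_combination h3)
    have hfc : f - algebraMap K W.FunctionField c =
        ((yF W) - algebraMap K W.FunctionField β) / algebraMap K W.FunctionField (2 * b) := by
      rw [eq_div_iff h2bF, sub_mul, hf, div_mul_cancel₀ _ h2bF, hβ]
      simp only [map_sub, map_mul]
      ring
    have hyβ0 : (yF W) - algebraMap K W.FunctionField β ≠ 0 :=
      fun h ↦ y_not_mem_range W ⟨β, (sub_eq_zero.1 h).symm⟩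
    have hord : P.ord (f - algebraMap K W.FunctionField c) =
        P.ord ((yF W) - algebraMap K W.FunctionField β) := by
      rw [hfc, P.ord_div hyβ0 h2bF, PlaceOver.ord_algebraMap_holds P h2b, sub_zero]
    rw [hord] at hP ⊢
    exact ord_y_sub_eq_one W h₁ h₂ h₃ h₄ hβ2 hP

/-- The degree of `f = (y + b)/(2b)` is `[K(W) : K(f)] = [K(W) : K(y)] = 3`. [folklore] -/
theorem finrank_adjoin_f [CharZero K] {b : K} (hb0 : b ≠ 0) :
    Module.finrank K⟮((yF W) + algebraMap K W.FunctionField b) /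
        algebraMap K W.FunctionField (2 * b)⟯ W.FunctionField = 3 := by
  set f := ((yF W) + algebraMap K W.FunctionField b) / algebraMap K W.FunctionField (2 * b) with hf
  have h2b : (2 * b : K) ≠ 0 := mul_ne_zero two_ne_zero hb0
  have h2bF : algebraMap K W.FunctionField (2 * b) ≠ 0 := (_root_.map_ne_zero _).2 h2b
  have hfy : f ∈ K⟮yF W⟯ :=
    div_mem (add_mem (IntermediateField.mem_adjoin_simple_self K _) (algebraMap_mem _ _))
      (algebraMap_mem _ _)
  have hyf : (yF W) ∈ K⟮f⟯ := by
    have : (yF W) = f * algebraMap K W.FunctionField (2 * b) - algebraMap K W.FunctionField b := by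
      rw [hf, div_mul_cancel₀ _ h2bF]; ring
    rw [this]
    exact sub_mem (mul_mem (IntermediateField.mem_adjoin_simple_self K f) (algebraMap_mem _ _))
      (algebraMap_mem _ _)
  have heq : K⟮f⟯ = K⟮yF W⟯ :=
    le_antisymm (IntermediateField.adjoin_simple_le_iff.2 hfy)
      (IntermediateField.adjoin_simple_le_iff.2 hyf)
  rw [heq]
  exact finrank_adjoin_y W

omit [IsDedekindDomain W.CoordinateRing] [IsAlgClosed K] in
/-- `a₆ ≠ 0` for an elliptic `W : y² = x³ + a₆`. [folklore] -/
theorem a₆_ne_zero [W.IsElliptic] (h₁ : W.a₁ = 0) (h₂ : W.a₂ = 0) (h₃ : W.a₃ = 0)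
    (h₄ : W.a₄ = 0) : W.a₆ ≠ 0 := by
  intro h6
  have hΔ := W.isUnit_Δ.ne_zero
  apply hΔ
  simp only [WeierstrassCurve.Δ, WeierstrassCurve.b₂, WeierstrassCurve.b₄, WeierstrassCurve.b₆,
    WeierstrassCurve.b₈, h₁, h₂, h₃, h₄, h6]
  ring

/-- **`deg_B(E) = 3` for the elliptic curves `y² = x³ + a₆` (`j = 0`)**: the lower bound
`deg_B(E) ≥ 2g + 1 = 3` of [Javanpeykar 2014, Lemma 3.2.2] (`three_le_belyiDegree`) is sharp, the
Belyi function `(y + b)/(2b)` (`b² = a₆`) having degree `3`. Consequently the right-hand side of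
`javanpeykar2014_stableFaltingsHeight_le` takes its least possible value `13·10⁶·3⁵` on these
curves. [cite: Javanpeykar2014, Lemma 3.2.2] -/
theorem belyiDegree_eq_three [W.IsElliptic] [CharZero K] (h₁ : W.a₁ = 0) (h₂ : W.a₂ = 0)
    (h₃ : W.a₃ = 0) (h₄ : W.a₄ = 0) : belyiDegree K W.FunctionField = 3 := by
  obtain ⟨b, hb⟩ := IsAlgClosed.exists_pow_nat_eq W.a₆ (by norm_num : 0 < 2)
  have hb0 : b ≠ 0 := by
    rintro rfl
    exact a₆_ne_zero W h₁ h₂ h₃ h₄ (by rw [← hb]; norm_num)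
  have hf := isBelyiFunction W h₁ h₂ h₃ h₄ hb hb0
  refine le_antisymm ?_ (three_le_belyiDegree W ⟨_, hf⟩)
  have h := belyiDegree_le_finrank hf
  rwa [finrank_adjoin_f W hb0] at h

/-! ### The double cover `x : E → ℙ¹`, and `deg_B ≤ 4` for `y² = x³ + a₄ x` (`j = 1728`) -/

omit [IsDedekindDomain W.CoordinateRing] [IsAlgClosed K] in
/-- `v_∞(x) = -2`. [cite: SilvermanAEC2009, Prop. III.3.1 (proof of (a))] -/
theorem ord_infPlace_x : (infPlace W).ord (xF W) = -2 := by
  have hval := infValuationF_x W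
  have hx0 : (xF W) ≠ 0 := by
    intro h; rw [h, Valuation.map_zero] at hval; exact (coe_ne_zero).symm hval |>.elim
  have key : ∀ n : ℤ, (-n ≤ (infPlace W).ord (xF W)) ↔ 2 ≤ n := by
    intro n
    rw [← (infPlace W).valuation_le_zpow_iff_le_ord hx0 (-n),
      WeierstrassGenus.infPlace_valuation_le_iff, hval, exp_le_exp]
  have h2 := (key 2).2 le_rfl
  have h1 : ¬ (-1 ≤ (infPlace W).ord (xF W)) := fun h ↦ by have := (key 1).1 h; omega
  omega

omit [IsDedekindDomain W.CoordinateRing] [IsAlgClosed K] in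
/-- `x ∉ K`. [folklore] -/
theorem x_not_mem_range : (xF W) ∉ Set.range (algebraMap K W.FunctionField) := by
  rintro ⟨c, hc⟩
  have h := ord_infPlace_x W
  rw [← hc] at h
  rcases eq_or_ne c 0 with rfl | hc0
  · rw [map_zero, PlaceOver.ord_zero] at h; omega
  · rw [PlaceOver.ord_algebraMap_holds _ hc0] at h; omega

omit [IsAlgClosed K] in
/-- `x` is integral at every finite place. [folklore] -/
theorem x_mem_ofPrime (v : IsDedekindDomain.HeightOneSpectrum W.CoordinateRing) :
    (xF W) ∈ (PlaceOver.ofPrime K W.FunctionField v).toValuationSubring := by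
  rw [PlaceOver.mem_ofPrime_iff,
    IsScalarTower.algebraMap_apply K[X] W.CoordinateRing W.FunctionField]
  exact v.valuation_le_one _

omit [IsAlgClosed K] in
/-- The only pole of `x` is `P_∞`. [folklore] -/
theorem eq_infPlace_of_ord_x_neg {P : PlaceOver K W.FunctionField} (hP : P.ord (xF W) < 0) :
    P = infPlace W := by
  rcases eq_infPlace_or_exists_eq_ofPrime W P with rfl | ⟨v, rfl⟩
  · rfl
  · exfalso
    have hx0 : (xF W) ≠ 0 := by
      intro h; rw [h, PlaceOver.ord_zero] at hP; exact lt_irrefl _ hP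
    have := ((PlaceOver.ofPrime K W.FunctionField v).mem_toValuationSubring_iff_ord_nonneg hx0).1
      (x_mem_ofPrime W v)
    omega

/-- **`[K(W) : K(x)] = 2`** (Silverman Cor. III.3.1.1): the only pole of `x` is `P_∞`, of order `2`.
[cite: SilvermanAEC2009, Cor. III.3.1.1] -/
theorem finrank_adjoin_x : Module.finrank K⟮xF W⟯ W.FunctionField = 2 := by
  classical
  have hrat : ∀ P : PlaceOver K W.FunctionField, P.IsRational :=
    PlaceOver.isRational_of_isAlgClosed
  have h := sum_neg_ord_eq_finrank hrat (x_not_mem_range W) {infPlace W}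
    (fun P hP ↦ by rw [Finset.mem_singleton.1 hP, ord_infPlace_x]; norm_num)
    (fun P hP ↦ Finset.mem_singleton.2 (eq_infPlace_of_ord_x_neg W hP))
  rw [Finset.sum_singleton, ord_infPlace_x] at h
  norm_num at h
  exact_mod_cast h.symm

omit [IsDedekindDomain W.CoordinateRing] [IsAlgClosed K] in
/-- Places centred at different `y`-coordinates are different. [folklore] -/
theorem ne_of_valuation_y_sub_lt {P : PlaceOver K W.FunctionField} {s s' : K}
    (h : P.valuation ((yF W) - algebraMap K W.FunctionField s) < 1)
    (h' : P.valuation ((yF W) - algebraMap K W.FunctionField s') < 1) : s = s' := by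
  by_contra hne
  have hc : s' - s ≠ 0 := sub_ne_zero.2 (Ne.symm hne)
  have hv1 : P.valuation (algebraMap K W.FunctionField (s' - s)) = 1 := by
    rw [P.valuation_eq_zpow_ord ((_root_.map_ne_zero _).2 hc), PlaceOver.ord_algebraMap_holds P hc,
      zpow_zero]
  have heq : algebraMap K W.FunctionField (s' - s) =
      ((yF W) - algebraMap K W.FunctionField s) - ((yF W) - algebraMap K W.FunctionField s') := by
    rw [map_sub]; ring
  have hlt : P.valuation (algebraMap K W.FunctionField (s' - s)) < 1 := by
    rw [heq]
    exact lt_of_le_of_lt (Valuation.map_sub _ _ _) (max_lt h h')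
  rw [hv1] at hlt
  exact lt_irrefl _ hlt

omit [IsDedekindDomain W.CoordinateRing] [IsAlgClosed K] in
/-- `∂Φ/∂y (a, b) = 2b + a₁a + a₃`. [folklore] -/
theorem evalEval_derivative_polynomial (a b : K) :
    (derivative W.polynomial).evalEval a b = 2 * b + W.a₁ * a + W.a₃ := by
  rw [WeierstrassCurve.Affine.polynomial]
  simp only [derivative_sub, derivative_add, derivative_mul, derivative_C, derivative_X,
    derivative_pow, mul_one, zero_mul, sub_zero, Nat.cast_ofNat, zero_add,
    evalEval_add, evalEval_mul, evalEval_C, evalEval_X, eval_add, eval_mul, eval_C,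
    eval_X, Nat.add_one_sub_one, pow_one]
  norm_num
  ring

/-- **`x` is unramified away from the `2`-torsion**: for `W : y² = x³ + a₂x² + a₄x + a₆`
(`a₁ = a₃ = 0`) and `α` with `α³ + a₂α² + a₄α + a₆ ≠ 0`, every zero of `x - α` is simple
(`v_P(x - α) = 1`): the two points `(α, ±s)` are nonsingular with `∂Φ/∂y = 2s ≠ 0`, carry two
distinct places, and `Σ_P v_P(x - α) = [K(W) : K(x)] = 2`.
[cite: SilvermanAEC2009, Prop. III.3.1] -/
theorem ord_x_sub_eq_one [W.IsElliptic] [CharZero K] (h₁ : W.a₁ = 0) (h₃ : W.a₃ = 0) {α : K}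
    (hα : α ^ 3 + W.a₂ * α ^ 2 + W.a₄ * α + W.a₆ ≠ 0) {P : PlaceOver K W.FunctionField}
    (hP : 0 < P.ord ((xF W) - algebraMap K W.FunctionField α)) :
    P.ord ((xF W) - algebraMap K W.FunctionField α) = 1 := by
  classical
  have hrat : ∀ P : PlaceOver K W.FunctionField, P.IsRational :=
    PlaceOver.isRational_of_isAlgClosed
  -- the two points `(α, ±s)`
  obtain ⟨s, hs⟩ := IsAlgClosed.exists_pow_nat_eq (α ^ 3 + W.a₂ * α ^ 2 + W.a₄ * α + W.a₆)
    (by norm_num : 0 < 2)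
  have hs0 : s ≠ 0 := by rintro rfl; rw [zero_pow two_ne_zero] at hs; exact hα hs.symm
  set pts : Fin 2 → K := ![s, -s] with hpts
  have hsq : ∀ i, pts i ^ 2 = s ^ 2 := by intro i; fin_cases i <;> simp [pts]
  have hinj : Function.Injective pts := by
    intro i j hij
    fin_cases i <;> fin_cases j
    · rfl
    · exfalso; change s = -s at hij; exact hs0 (by linear_combination hij / 2)
    · exfalso; change -s = s at hij; exact hs0 (by linear_combination -hij / 2)
    · rfl
  have hxa : (xF W) ≠ algebraMap K W.FunctionField α := fun h ↦ x_not_mem_range W ⟨α, h.symm⟩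
  have hplace : ∀ i, ∃ P : PlaceOver K W.FunctionField,
      P.valuation ((xF W) - algebraMap K W.FunctionField α) < 1 ∧
      P.valuation ((yF W) - algebraMap K W.FunctionField (pts i)) < 1 := by
    intro i
    have hab : W.polynomial.evalEval α (pts i) = 0 := by
      rw [WeierstrassCurve.Affine.evalEval_polynomial, h₁, h₃, hsq i, hs]; ring
    have hder : (derivative W.polynomial).evalEval α (pts i) ≠ 0 := by
      rw [evalEval_derivative_polynomial, h₁, h₃, zero_mul, add_zero, add_zero]
      refine mul_ne_zero two_ne_zero fun h ↦ hs0 ?_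
      fin_cases i
      · simpa [pts] using h
      · simpa [pts] using h
    obtain ⟨P, -, -, -, hvx, hvy, -⟩ := exists_place_of_derivative_ne_zero
      (evalEval_polynomial_eq_zero W) (polynomial_dvd_of_evalEval_eq_zero W)
      (exists_evalEval_div W) hxa hab hder
    exact ⟨P, hvx, hvy⟩
  choose Q hQx hQy using hplace
  have hQinj : Function.Injective Q := fun i j hij ↦
    hinj (ne_of_valuation_y_sub_lt W (hQy i) (by rw [hij]; exact hQy j))
  -- the zero set of `x - α` and the sum formula
  have hxα0 : (xF W) - algebraMap K W.FunctionField α ≠ 0 := sub_ne_zero.2 hxa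
  set U : Finset (PlaceOver K W.FunctionField) :=
    (finite_setOf_ord_ne_zero_holds (K := K) hxα0).toFinset.filter
      fun P ↦ 0 < P.ord ((xF W) - algebraMap K W.FunctionField α) with hU
  have hmemU : ∀ R, R ∈ U ↔ 0 < R.ord ((xF W) - algebraMap K W.FunctionField α) := fun R ↦ by
    rw [hU, Finset.mem_filter, Set.Finite.mem_toFinset, Set.mem_setOf_eq]
    exact ⟨fun h ↦ h.2, fun h ↦ ⟨h.ne', h⟩⟩
  have hsum := sum_ord_sub_eq_finrank hrat (x_not_mem_range W) α U
    (fun R hR ↦ (hmemU R).1 hR) (fun R hR ↦ (hmemU R).2 hR)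
  rw [finrank_adjoin_x] at hsum
  have hQU : ∀ i, Q i ∈ U := fun i ↦ (hmemU _).2
    ((Q i).valuation_lt_one_iff_ord_pos hxα0 |>.1 (hQx i))
  have himg : (Finset.univ.image Q) ⊆ U := by
    intro R hR
    obtain ⟨i, -, rfl⟩ := Finset.mem_image.1 hR
    exact hQU i
  have hcard2 : (Finset.univ.image Q).card = 2 := by
    rw [Finset.card_image_of_injective _ hQinj, Finset.card_univ, Fintype.card_fin]
  have hterms : ∀ R ∈ U, 1 ≤ R.ord ((xF W) - algebraMap K W.FunctionField α) :=
    fun R hR ↦ (hmemU R).1 hR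
  have hcardU : U.card ≤ 2 := by
    have h := Finset.sum_le_sum hterms
    rw [Finset.sum_const, nsmul_eq_mul, mul_one, hsum] at h
    exact_mod_cast h
  have hUeq : Finset.univ.image Q = U :=
    Finset.eq_of_subset_of_card_le himg (by rw [hcard2]; exact hcardU)
  have hcardU2 : U.card = 2 := by rw [← hUeq, hcard2]
  have hPU : P ∈ U := (hmemU P).2 hP
  by_contra hne
  have hgt : 2 ≤ P.ord ((xF W) - algebraMap K W.FunctionField α) := by
    have := hterms P hPU; omega
  have h := Finset.add_sum_erase U (fun R ↦ R.ord ((xF W) - algebraMap K W.FunctionField α)) hPU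
  have hrest : ((U.erase P).card : ℤ) ≤
      ∑ R ∈ U.erase P, R.ord ((xF W) - algebraMap K W.FunctionField α) := by
    have h2 := Finset.sum_le_sum (s := U.erase P) fun R hR ↦ hterms R (Finset.mem_of_mem_erase hR)
    rwa [Finset.sum_const, nsmul_eq_mul, mul_one] at h2
  rw [Finset.card_erase_of_mem hPU, hcardU2] at hrest
  rw [hsum] at h
  push_cast at hrest h
  linarith

omit [IsDedekindDomain W.CoordinateRing] [IsAlgClosed K] in
/-- `a₄ ≠ 0` for an elliptic `W : y² = x³ + a₄ x`. [folklore] -/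
theorem a₄_ne_zero [W.IsElliptic] (h₁ : W.a₁ = 0) (h₂ : W.a₂ = 0) (h₃ : W.a₃ = 0)
    (h₆ : W.a₆ = 0) : W.a₄ ≠ 0 := by
  intro h4
  have hΔ := W.isUnit_Δ.ne_zero
  apply hΔ
  simp only [WeierstrassCurve.Δ, WeierstrassCurve.b₂, WeierstrassCurve.b₄, WeierstrassCurve.b₆,
    WeierstrassCurve.b₈, h₁, h₂, h₃, h4, h₆]
  ring

/-- **A Belyi function of degree `4` on `y² = x³ + a₄ x` (`j = 1728`)**: `f = -x²/a₄` — the double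
cover `x` is branched at `x = 0, ±√(-a₄), ∞`, and `x ↦ -x²/a₄` (ramified only at `0, ∞`) sends these
to `{0, 1, ∞}`. [cite: Javanpeykar2014, Lemma 3.2.2] -/
theorem isBelyiFunction_j1728 [W.IsElliptic] [CharZero K] (h₁ : W.a₁ = 0) (h₂ : W.a₂ = 0)
    (h₃ : W.a₃ = 0) (h₆ : W.a₆ = 0) :
    IsBelyiFunction K (algebraMap K W.FunctionField (-W.a₄⁻¹) * (xF W) ^ 2) := by
  have ha4 := a₄_ne_zero W h₁ h₂ h₃ h₆
  set f := algebraMap K W.FunctionField (-W.a₄⁻¹) * (xF W) ^ 2 with hf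
  have hx0 : (xF W) ≠ 0 := fun h ↦ x_not_mem_range W ⟨0, by rw [map_zero, h]⟩
  have hcst : algebraMap K W.FunctionField (-W.a₄⁻¹) ≠ 0 :=
    (_root_.map_ne_zero _).2 (neg_ne_zero.2 (inv_ne_zero ha4))
  refine ⟨?_, ?_⟩
  · -- `f ∉ K`: it has a pole of order `4` at `P_∞`
    rintro ⟨c, hc⟩
    have h := ord_infPlace_x W
    have hordf : (infPlace W).ord f = -4 := by
      rw [hf, (infPlace W).ord_mul_eq hcst (pow_ne_zero _ hx0),
        PlaceOver.ord_algebraMap_holds _ (neg_ne_zero.2 (inv_ne_zero ha4)),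
        (infPlace W).ord_pow hx0, h]
      norm_num
    rw [← hc] at hordf
    rcases eq_or_ne c 0 with rfl | hc0
    · rw [map_zero, PlaceOver.ord_zero] at hordf; omega
    · rw [PlaceOver.ord_algebraMap_holds _ hc0] at hordf; omega
  · intro c hc0 hc1 P hP
    -- `f - c = -(x - r)(x + r)/a₄` with `r² = -a₄ c`
    obtain ⟨r, hr⟩ := IsAlgClosed.exists_pow_nat_eq (-W.a₄ * c) (by norm_num : 0 < 2)
    have hr0 : r ≠ 0 := by
      rintro rfl
      rw [zero_pow two_ne_zero] at hr
      exact mul_ne_zero (neg_ne_zero.2 ha4) hc0 hr.symm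
    have hfac : f - algebraMap K W.FunctionField c =
        algebraMap K W.FunctionField (-W.a₄⁻¹) *
          (((xF W) - algebraMap K W.FunctionField r) *
            ((xF W) + algebraMap K W.FunctionField r)) := by
      have hc' : algebraMap K W.FunctionField c =
          algebraMap K W.FunctionField (-W.a₄⁻¹) * algebraMap K W.FunctionField (r ^ 2) := by
        rw [hr, ← map_mul]; congr 1; field_simp
      rw [hc', hf, map_pow]; ring
    have hxr : (xF W) - algebraMap K W.FunctionField r ≠ 0 :=
      fun h ↦ x_not_mem_range W ⟨r, (sub_eq_zero.1 h).symm⟩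
    have hxr' : (xF W) + algebraMap K W.FunctionField r ≠ 0 := by
      intro h
      apply x_not_mem_range W
      exact ⟨-r, by rw [map_neg]; exact (eq_neg_of_add_eq_zero_left h).symm⟩
    have hord : P.ord (f - algebraMap K W.FunctionField c) =
        P.ord ((xF W) - algebraMap K W.FunctionField r) +
          P.ord ((xF W) + algebraMap K W.FunctionField r) := by
      rw [hfac, P.ord_mul_eq hcst (mul_ne_zero hxr hxr'),
        PlaceOver.ord_algebraMap_holds _ (neg_ne_zero.2 (inv_ne_zero ha4)), zero_add,
        P.ord_mul_eq hxr hxr']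
    -- the cubic does not vanish at `±r`
    have hcubic : ∀ ρ : K, ρ ^ 2 = -W.a₄ * c → ρ ^ 3 + W.a₂ * ρ ^ 2 + W.a₄ * ρ + W.a₆ ≠ 0 := by
      intro ρ hρ h0
      rw [h₂, h₆] at h0
      have hρ0 : ρ ≠ 0 := by
        rintro rfl; rw [zero_pow two_ne_zero] at hρ
        exact mul_ne_zero (neg_ne_zero.2 ha4) hc0 hρ.symm
      have h1 : ρ * (W.a₄ * (1 - c)) = 0 := by linear_combination h0 - ρ * hρ
      rcases mul_eq_zero.1 h1 with h | h
      · exact hρ0 h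
      · rcases mul_eq_zero.1 h with h | h
        · exact ha4 h
        · exact hc1 (by linear_combination -h)
    -- one of `x ∓ r` vanishes at `P`, the other is a unit
    have hx2r : ((xF W) + algebraMap K W.FunctionField r) =
        ((xF W) - algebraMap K W.FunctionField r) + algebraMap K W.FunctionField (2 * r) := by
      rw [map_mul]; simp only [map_ofNat]; ring
    have h2r : (2 * r : K) ≠ 0 := mul_ne_zero two_ne_zero hr0
    rw [hord] at hP ⊢
    rcases lt_trichotomy (P.ord ((xF W) - algebraMap K W.FunctionField r)) 0 with
      hneg | hzero | hpos
    · -- impossible: then also `x + r` has a pole and the sum is negative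
      exfalso
      have hlt : P.ord ((xF W) - algebraMap K W.FunctionField r) <
          P.ord (algebraMap K W.FunctionField (2 * r)) := by
        rw [PlaceOver.ord_algebraMap_holds _ h2r]; exact hneg
      have h := P.ord_add_eq_left_of_lt hxr ((_root_.map_ne_zero _).2 h2r) hlt
      rw [← hx2r] at h
      omega
    · -- `x - r` is a unit: then `x + r` vanishes, simply
      rw [hzero, zero_add] at hP ⊢
      have hP' : 0 < P.ord ((xF W) - algebraMap K W.FunctionField (-r)) := by
        rwa [map_neg, sub_neg_eq_add]
      have := ord_x_sub_eq_one W h₁ h₃ (hcubic (-r) (by rw [neg_sq, hr])) hP'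
      rwa [map_neg, sub_neg_eq_add] at this
    · -- `x - r` vanishes simply, `x + r` is a unit
      have hunit : P.ord ((xF W) + algebraMap K W.FunctionField r) = 0 := by
        have hlt : P.ord (algebraMap K W.FunctionField (2 * r)) <
            P.ord ((xF W) - algebraMap K W.FunctionField r) := by
          rw [PlaceOver.ord_algebraMap_holds _ h2r]; exact hpos
        have h := P.ord_add_eq_left_of_lt ((_root_.map_ne_zero _).2 h2r) hxr hlt
        rw [add_comm, ← hx2r] at h
        rw [h.2, PlaceOver.ord_algebraMap_holds _ h2r]
      rw [hunit, add_zero] at hP ⊢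
      exact ord_x_sub_eq_one W h₁ h₃ (hcubic r hr) hpos

/-- The degree of `f = -x²/a₄` is `[K(W) : K(f)] = 4`: `P_∞` is its only pole, of order `4`.
[folklore] -/
theorem finrank_adjoin_j1728 [W.IsElliptic] [CharZero K] (h₁ : W.a₁ = 0) (h₂ : W.a₂ = 0)
    (h₃ : W.a₃ = 0) (h₆ : W.a₆ = 0) :
    Module.finrank K⟮algebraMap K W.FunctionField (-W.a₄⁻¹) * (xF W) ^ 2⟯ W.FunctionField = 4 := by
  classical
  have ha4 := a₄_ne_zero W h₁ h₂ h₃ h₆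
  have hrat : ∀ P : PlaceOver K W.FunctionField, P.IsRational :=
    PlaceOver.isRational_of_isAlgClosed
  set f := algebraMap K W.FunctionField (-W.a₄⁻¹) * (xF W) ^ 2 with hf
  have hx0 : (xF W) ≠ 0 := fun h ↦ x_not_mem_range W ⟨0, by rw [map_zero, h]⟩
  have hcst0 : (-W.a₄⁻¹ : K) ≠ 0 := neg_ne_zero.2 (inv_ne_zero ha4)
  have hcst : algebraMap K W.FunctionField (-W.a₄⁻¹) ≠ 0 := (_root_.map_ne_zero _).2 hcst0
  have hordf : ∀ P : PlaceOver K W.FunctionField, P.ord f = 2 * P.ord (xF W) := by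
    intro P
    rw [hf, P.ord_mul_eq hcst (pow_ne_zero _ hx0), PlaceOver.ord_algebraMap_holds _ hcst0,
      P.ord_pow hx0]
    ring
  have hfK : f ∉ Set.range (algebraMap K W.FunctionField) := (isBelyiFunction_j1728 W h₁ h₂ h₃ h₆).1
  have h := sum_neg_ord_eq_finrank hrat hfK {infPlace W}
    (fun P hP ↦ by rw [Finset.mem_singleton.1 hP, hordf, ord_infPlace_x]; norm_num)
    (fun P hP ↦ Finset.mem_singleton.2 (eq_infPlace_of_ord_x_neg W (by
      have := hordf P; omega)))
  rw [Finset.sum_singleton, hordf, ord_infPlace_x] at h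
  norm_num at h
  exact_mod_cast h.symm

/-- **`3 ≤ deg_B(E) ≤ 4` for the elliptic curves `y² = x³ + a₄ x` (`j = 1728`)** — the lower bound
is Lemma 3.2.2, the upper bound the Belyi function `-x²/a₄` of degree `4`. (The expected value is
`4`: a degree-`3` Belyi map is totally ramified over three points,
`ord_eq_three_of_finrank_eq_three`,
hence cyclic, forcing `j = 0` — not proved here.) [cite: Javanpeykar2014, Lemma 3.2.2] -/
theorem belyiDegree_j1728 [W.IsElliptic] [CharZero K] (h₁ : W.a₁ = 0) (h₂ : W.a₂ = 0)
    (h₃ : W.a₃ = 0) (h₆ : W.a₆ = 0) :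
    3 ≤ belyiDegree K W.FunctionField ∧ belyiDegree K W.FunctionField ≤ 4 := by
  have hf := isBelyiFunction_j1728 W h₁ h₂ h₃ h₆
  refine ⟨three_le_belyiDegree W ⟨_, hf⟩, ?_⟩
  have h := belyiDegree_le_finrank hf
  rwa [finrank_adjoin_j1728 W h₁ h₂ h₃ h₆] at h

end WeierstrassBelyi

/-! ### Degree-`3` Belyi functions in genus one are totally ramified over `0, 1, ∞` -/

namespace AlgFunctionField.IsBelyiFunction

variable {K' : Type u} {F : Type u} [Field K'] [Field F] [Algebra K' F] [IsAlgFunctionField K' F]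
  [IsAlgClosed K'] [CharZero K']

/-- **A Belyi function of degree `3` on a genus-one function field is totally ramified over
`0, 1, ∞`**: the cusp count `n₀ + n₁ + n_∞ = d + 2 - 2g = 3` (`card_add_card_add_card_eq`) with
three non-empty fibres forces one place in each fibre, of ramification index `3`: every zero of
`f` and of `f - 1` has order `3` and the pole has order `3`. (So a Belyi map of the minimal degree
`deg_B = 3` on an elliptic curve — e.g. `(y + b)/(2b)` on `y² = x³ + b²`,
`WeierstrassBelyi.isBelyiFunction` — looks like `y : (x, y) ↦ y` on a `j = 0` curve.)
[cite: Javanpeykar2014, Lemma 3.2.2] -/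
theorem ord_eq_three_of_finrank_eq_three {f : F} (hf : IsBelyiFunction K' f)
    (hg : genus K' F = 1) (hd : Module.finrank K'⟮f⟯ F = 3) :
    (∀ P : PlaceOver K' F, 0 < P.ord f → P.ord f = 3) ∧
      (∀ P : PlaceOver K' F, 0 < P.ord (f - 1) → P.ord (f - 1) = 3) ∧
      (∀ P : PlaceOver K' F, P.ord f < 0 → P.ord f = -3) := by
  classical
  haveI := isIntegrallyClosedIn_of_isAlgClosed (K := K') (F := F)
  have hrat : ∀ P : PlaceOver K' F, P.IsRational := PlaceOver.isRational_of_isAlgClosed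
  have hy := hf.not_mem_range
  have hf0 : f ≠ 0 := hf.ne_zero
  have hf1 : f - 1 ≠ 0 := hf.sub_one_ne_zero
  set U₀ : Finset (PlaceOver K' F) :=
    (finite_setOf_ord_ne_zero_holds (K := K') hf0).toFinset.filter fun P ↦ 0 < P.ord f with hU₀
  set U₁ : Finset (PlaceOver K' F) :=
    (finite_setOf_ord_ne_zero_holds (K := K') hf1).toFinset.filter fun P ↦ 0 < P.ord (f - 1)
    with hU₁
  set Ui : Finset (PlaceOver K' F) :=
    (finite_setOf_ord_ne_zero_holds (K := K') hf0).toFinset.filter fun P ↦ P.ord f < 0 with hUi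
  have hmem₀ : ∀ P, P ∈ U₀ ↔ 0 < P.ord f := fun P ↦ by
    rw [hU₀, Finset.mem_filter, Set.Finite.mem_toFinset, Set.mem_setOf_eq]
    exact ⟨fun h ↦ h.2, fun h ↦ ⟨h.ne', h⟩⟩
  have hmem₁ : ∀ P, P ∈ U₁ ↔ 0 < P.ord (f - 1) := fun P ↦ by
    rw [hU₁, Finset.mem_filter, Set.Finite.mem_toFinset, Set.mem_setOf_eq]
    exact ⟨fun h ↦ h.2, fun h ↦ ⟨h.ne', h⟩⟩
  have hmemi : ∀ P, P ∈ Ui ↔ P.ord f < 0 := fun P ↦ by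
    rw [hUi, Finset.mem_filter, Set.Finite.mem_toFinset, Set.mem_setOf_eq]
    exact ⟨fun h ↦ h.2, fun h ↦ ⟨h.ne, h⟩⟩
  -- the cusp count: `#U₀ + #U₁ + #U_∞ = 3`
  have hRH := hf.card_add_card_add_card_eq_of_isAlgClosed U₀ U₁ Ui hmem₀ hmem₁ hmemi
  rw [hd, hg] at hRH
  -- the fibre sums: each equals `3`
  have hs₀ := sum_ord_sub_eq_finrank hrat hy 0 U₀
    (fun P hP ↦ by rw [map_zero, sub_zero]; exact (hmem₀ P).1 hP)
    (fun P hP ↦ by rw [map_zero, sub_zero] at hP; exact (hmem₀ P).2 hP)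
  simp only [map_zero, sub_zero] at hs₀
  have hs₁ := sum_ord_sub_eq_finrank hrat hy 1 U₁
    (fun P hP ↦ by rw [map_one]; exact (hmem₁ P).1 hP)
    (fun P hP ↦ by rw [map_one] at hP; exact (hmem₁ P).2 hP)
  simp only [map_one] at hs₁
  have hsi := sum_neg_ord_eq_finrank hrat hy Ui (fun P hP ↦ (hmemi P).1 hP)
    (fun P hP ↦ (hmemi P).2 hP)
  rw [hd] at hs₀ hs₁ hsi
  -- each fibre is non-empty, hence a singleton
  have hne : ∀ {U : Finset (PlaceOver K' F)} {g : PlaceOver K' F → ℤ},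
      ∑ P ∈ U, g P = ((3 : ℕ) : ℤ) → 1 ≤ U.card := by
    intro U g h
    by_contra hlt
    have : U = ∅ := Finset.card_eq_zero.1 (by omega)
    rw [this, Finset.sum_empty] at h
    norm_num at h
  have h₀ := hne hs₀
  have h₁ := hne hs₁
  have hi := hne hsi
  have hc₀ : U₀.card = 1 := by push_cast at hRH; omega
  have hc₁ : U₁.card = 1 := by push_cast at hRH; omega
  have hci : Ui.card = 1 := by push_cast at hRH; omega
  obtain ⟨P₀, hP₀⟩ := Finset.card_eq_one.1 hc₀
  obtain ⟨P₁, hP₁⟩ := Finset.card_eq_one.1 hc₁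
  obtain ⟨Pinf, hPi⟩ := Finset.card_eq_one.1 hci
  rw [hP₀, Finset.sum_singleton] at hs₀
  rw [hP₁, Finset.sum_singleton] at hs₁
  rw [hPi, Finset.sum_singleton] at hsi
  refine ⟨fun P hP ↦ ?_, fun P hP ↦ ?_, fun P hP ↦ ?_⟩
  · have : P = P₀ := Finset.mem_singleton.1 (hP₀ ▸ (hmem₀ P).2 hP)
    subst this; exact_mod_cast hs₀
  · have : P = P₁ := Finset.mem_singleton.1 (hP₁ ▸ (hmem₁ P).2 hP)
    subst this; exact_mod_cast hs₁
  · have : P = Pinf := Finset.mem_singleton.1 (hPi ▸ (hmemi P).2 hP)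
    subst this
    have : -P.ord f = 3 := by exact_mod_cast hsi
    omega

end AlgFunctionField.IsBelyiFunction

/-! ### The setting of the named fact: `j = 0` curves over number fields -/

/-- **`deg_B(E_Ω) = 3` for `E : y² = x³ + B` over a number field** (`B ≠ 0`, `Ω` an algebraic
closure): the Belyi degree in `javanpeykar2014_stableFaltingsHeight_le` equals `3` for these
curves. [cite: Javanpeykar2014, Lemma 3.2.2] -/
theorem belyiDegree_baseChange_eq_three (K : Type) [Field K] [NumberField K]
    (W : WeierstrassCurve K) [W.IsElliptic] (h₁ : W.a₁ = 0) (h₂ : W.a₂ = 0) (h₃ : W.a₃ = 0)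
    (h₄ : W.a₄ = 0) (Ω : Type) [Field Ω] [Algebra K Ω] [IsAlgClosure K Ω] :
    belyiDegree Ω (W.baseChange Ω).toAffine.FunctionField = 3 := by
  haveI : IsAlgClosed Ω := IsAlgClosure.isAlgClosed K
  haveI : CharZero Ω := charZero_of_injective_algebraMap (algebraMap K Ω).injective
  haveI : (W.baseChange Ω).IsElliptic := by rw [WeierstrassCurve.baseChange]; infer_instance
  exact WeierstrassBelyi.belyiDegree_eq_three (W.baseChange Ω).toAffine
    (by simp [WeierstrassCurve.baseChange, h₁]) (by simp [WeierstrassCurve.baseChange, h₂])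
    (by simp [WeierstrassCurve.baseChange, h₃]) (by simp [WeierstrassCurve.baseChange, h₄])

/-- **Javanpeykar's bound at its smallest: `h_F(E) ≤ 13·10⁶ · 3⁵` for `E : y² = x³ + B`** over a
number field, modulo the named fact (`deg_B(E_Ω) = 3`). Numerically `3.159·10⁹`; the true value is
Deligne's `h_F(j = 0) = -1.3211…`. [cite: Javanpeykar2014, Thm. 1.1.1] -/
theorem javanpeykar2014_stableFaltingsHeight_le.j_zero (h : javanpeykar2014_stableFaltingsHeight_le)
    (K : Type) [Field K] [NumberField K] (W : WeierstrassCurve K) [W.IsElliptic] (h₁ : W.a₁ = 0)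
    (h₂ : W.a₂ = 0) (h₃ : W.a₃ = 0) (h₄ : W.a₄ = 0) :
    W.stableFaltingsHeight ≤ 13 * 10 ^ 6 * 3 ^ 5 := by
  have hb := h.le_belyiDegree_pow' K W (AlgebraicClosure K)
  rw [belyiDegree_baseChange_eq_three K W h₁ h₂ h₃ h₄ (AlgebraicClosure K)] at hb
  exact_mod_cast hb


end Literature.NumberTheory.DiophantineGeometry

end
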